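import Summits.SmoothPoincare4.SmoothPoincare4.Theorems.SymplecticOrigamiOrigamiFoldExistenceStubCleanOnePleatIroningRadial
import Literature.Topology.FourManifolds.FrameSignsAlongPaths
import Literature.Topology.FourManifolds.CollarUniquenessBall
import Mathlib.Analysis.Calculus.InverseFunctionTheorem.ContDiff

/-!
# Stub `stub_cleanOnePleatIroning` of line `shadow-pleats` for crux `OrigamiFoldExistence` — XI:
# smooth inverses of injective immersions and the INNER COLLAR of the crease
(item stmt-SmoothPoincare4-7844, route SymplecticOrigami; seat c3, S5a worker, wave 2)

Eleventh helper file for the registered stub `stub_cleanOnePleatIroning` (S5a): the point-set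
and calculus packaging of step (S3) (collar correction) of its remaining ingredient
`CleanPleatIroningChart` (file III); it imports only file VI (the conclusion of file X is an
INPUT here).  In the setting of file X (`G, Λ₀ : ℝ⁴ → ℝ⁴` smooth,
`Λ₀ = G` on the sphere `S_R`, `Λ₀` an injective immersion of a larger ball `B_{R'}`, `G` an
injective immersion of an open shell `{R - η₀ < |u| < R + η₀}`, and the inner shell mapped by
`G` into `Λ₀(B_R)` — the conclusion of file X):

* `exists_contDiffOn_leftInverse` — **a smooth injective immersion of an open set of `ℝ⁴` has
  a smooth inverse on its (open) image** (the local inverses of the inverse function theorem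
  agree with the set-theoretic inverse);
* `exists_isInnerCollar` (registered sub-goal) — **the chart collar, read in the filled ball
  and rescaled to the unit ball, is an inner collar of the unit sphere** in the sense of the
  tree's `Literature.Topology.FourManifolds.IsInnerCollar` (`CollarUniquenessBall.lean`):
  `θ x = R⁻¹ Λ₀⁻¹(G(R x))` on a closed shell `{1 - ε' < |x| ≤ 1}`, with smooth left inverse
  `x ↦ R⁻¹ G⁻¹(Λ₀(R x))`, fixing the unit sphere, mapping the open shell into the open ball.
  The tree's uniqueness-of-collars theorem (`IsInnerCollar.exists_openPartialHomeomorph_extend`)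
  then straightens it by a diffeomorphism of the open ball (file XII).

Sources: M. W. Hirsch, *Differential Topology* (1976), Ch. 4 §6 and Ch. 8 Thm. 1.8 (collars
and their uniqueness); the tree files `CollarUniquenessBall.lean`, `GlobalInverseContDiff.lean`
(pattern of `exists_contDiffOn_leftInverse`).
-/

noncomputable section

-- the prescribed namespace `Summit.<P>.<Sub>.…` duplicates `SmoothPoincare4` (P = Sub)
set_option linter.dupNamespace false

open scoped Manifold ContDiff Topology RealInnerProductSpace
open Set Function Filter Metric Module

namespace Summit.SmoothPoincare4.SmoothPoincare4.Theorems.OrigamiFoldExistence.ShadowPleats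

/-! ### Smooth inverses of injective immersions of open sets -/

section Inverse

variable {F : EuclideanSpace ℝ (Fin 4) → EuclideanSpace ℝ (Fin 4)}

/-- **A smooth injective immersion of an open subset of `ℝ⁴` has a smooth inverse on its
image**: there is `Finv : ℝ⁴ → ℝ⁴` with `Finv (F x) = x` for `x ∈ V` which is `C^∞` on the
open set `F(V)` (at `F x` it agrees with the local inverse of the inverse function theorem).
[folklore] -/
-- adapted from `contDiff_of_leftInverse_of_rightInverse` (Literature/Analysis/Calculus/GlobalInverseContDiff.lean)
theorem exists_contDiffOn_leftInverse (hF : ContDiff ℝ ∞ F) {V : Set (EuclideanSpace ℝ (Fin 4))}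
    (hV : IsOpen V) (hinj : InjOn F V) (himm : ∀ x ∈ V, Injective (fderiv ℝ F x)) :
    ∃ Finv : EuclideanSpace ℝ (Fin 4) → EuclideanSpace ℝ (Fin 4),
      (∀ x ∈ V, Finv (F x) = x) ∧ ContDiffOn ℝ ∞ Finv (F '' V) ∧ IsOpen (F '' V) := by
  -- at a point of `V` the differential is an equivalence and `F` is strictly differentiable
  have hstrict : ∀ a ∈ V, ∃ L : EuclideanSpace ℝ (Fin 4) ≃L[ℝ] EuclideanSpace ℝ (Fin 4),
      HasStrictFDerivAt F (L : EuclideanSpace ℝ (Fin 4) →L[ℝ] EuclideanSpace ℝ (Fin 4)) a := by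
    intro a ha
    refine ⟨(fderiv ℝ F a).toContinuousLinearEquivOfDetNeZero
      (Literature.Topology.FourManifolds.det_ne_zero_of_injective (himm a ha)), ?_⟩
    rw [ContinuousLinearMap.coe_toContinuousLinearEquivOfDetNeZero]
    exact hF.contDiffAt.hasStrictFDerivAt (by simp)
  refine ⟨invFunOn F V, fun x hx => hinj.leftInvOn_invFunOn hx, ?_, ?_⟩
  · rintro y ⟨a, ha, rfl⟩
    obtain ⟨L, hFs⟩ := hstrict a ha
    have hfa : ContDiffAt ℝ ∞ F a := hF.contDiffAt
    have hn : (∞ : WithTop ℕ∞) ≠ 0 := by simp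
    have hloc : ContDiffAt ℝ ∞ (hfa.localInverse hFs.hasFDerivAt hn) (F a) :=
      hfa.to_localInverse hFs.hasFDerivAt hn
    have heq : ∀ᶠ z in 𝓝 (F a), invFunOn F V z = hfa.localInverse hFs.hasFDerivAt hn z := by
      refine (hfa.hasStrictFDerivAt' hFs.hasFDerivAt hn).localInverse_unique ?_
      filter_upwards [hV.mem_nhds ha] with x hx
      exact hinj.leftInvOn_invFunOn hx
    exact (hloc.congr_of_eventuallyEq heq).contDiffWithinAt
  · -- the image of the open `V` is open (inverse function theorem)
    rw [isOpen_iff_mem_nhds]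
    rintro y ⟨x, hx, rfl⟩
    obtain ⟨L, hL⟩ := hstrict x hx
    rw [← hL.map_nhds_eq_of_equiv]
    exact image_mem_map (hV.mem_nhds hx)

end Inverse

/-! ### The inner collar of the crease in the filled ball -/

section Collar

variable {G Λ₀ : EuclideanSpace ℝ (Fin 4) → EuclideanSpace ℝ (Fin 4)}

/-- **The chart collar is an inner collar of the filled ball** (input of the uniqueness of
collars, step (S3)).  In the setting of `image_innerShell_subset` (file X) — `Λ₀ = G` on
`S_R`, `Λ₀` an injective immersion of `B_{R'}` (`R' > R`), `G` an injective immersion of the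
open shell `{R - η₀ < |u| < R + η₀}`, and the inner shell mapped by `G` into `Λ₀(B_R)` —
there are `ε' ∈ (0, η₀/R]` and maps `θ, θinv` forming an inner collar of the unit sphere
(`Literature.Topology.FourManifolds.IsInnerCollar ε' θ θinv`: `θ` smooth on the closed shell
`{1 - ε' < |x| ≤ 1}`, fixing the unit sphere, open shell into the open ball, with smooth left
inverse), namely `θ x = R⁻¹ Λ₀⁻¹(G(R x))`, so that `Λ₀ (R θ x) = G (R x)` on that shell.
[folklore] -/
theorem exists_isInnerCollar (hG : ContDiff ℝ ∞ G) (hΛ : ContDiff ℝ ∞ Λ₀) {R R' η₀ : ℝ}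
    (hR : 0 < R) (hRR' : R < R') (hη₀ : 0 < η₀) (hη₀R : η₀ < R)
    (hΛimm : ∀ u ∈ ball (0 : EuclideanSpace ℝ (Fin 4)) R', Injective (fderiv ℝ Λ₀ u))
    (hΛinj : InjOn Λ₀ (ball (0 : EuclideanSpace ℝ (Fin 4)) R'))
    (hagree : ∀ u : EuclideanSpace ℝ (Fin 4), ‖u‖ = R → Λ₀ u = G u)
    (hGinj : InjOn G {u : EuclideanSpace ℝ (Fin 4) | R - η₀ < ‖u‖ ∧ ‖u‖ < R + η₀})
    (hGimm : ∀ u : EuclideanSpace ℝ (Fin 4), R - η₀ < ‖u‖ → ‖u‖ < R + η₀ →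
      Injective (fderiv ℝ G u))
    (hT1 : G '' {u : EuclideanSpace ℝ (Fin 4) | R - η₀ < ‖u‖ ∧ ‖u‖ < R} ⊆ Λ₀ '' ball 0 R) :
    ∃ (ε' : ℝ) (θ θinv : EuclideanSpace ℝ (Fin 4) → EuclideanSpace ℝ (Fin 4)),
      0 < ε' ∧ ε' ≤ η₀ / R ∧ Literature.Topology.FourManifolds.IsInnerCollar ε' θ θinv ∧
      ∀ x : EuclideanSpace ℝ (Fin 4), 1 - ε' < ‖x‖ → ‖x‖ ≤ 1 → Λ₀ (R • θ x) = G (R • x) := by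
  -- smooth inverses of `Λ₀` on `B_{R'}` and of `G` on the open shell `C`
  obtain ⟨Λinv, hΛleft, hΛsmooth, hΛopen⟩ := exists_contDiffOn_leftInverse hΛ isOpen_ball hΛinj hΛimm
  set C : Set (EuclideanSpace ℝ (Fin 4)) := {u | R - η₀ < ‖u‖ ∧ ‖u‖ < R + η₀} with hC
  have hCopen : IsOpen C :=
    (isOpen_lt continuous_const continuous_norm).inter (isOpen_lt continuous_norm continuous_const)
  obtain ⟨Ginv, hGleft, hGsmooth, hGopen⟩ :=
    exists_contDiffOn_leftInverse hG hCopen hGinj fun u hu => hGimm u hu.1 hu.2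
  -- a uniform neighbourhood of the sphere `S_R` mapped by `Λ₀` into `G(C)`
  have hpre : IsOpen (Λ₀ ⁻¹' (G '' C)) := hGopen.preimage hΛ.continuous
  have hsph : sphere (0 : EuclideanSpace ℝ (Fin 4)) R ⊆ Λ₀ ⁻¹' (G '' C) := by
    intro u hu
    have huR : ‖u‖ = R := mem_sphere_zero_iff_norm.1 hu
    exact ⟨u, ⟨by rw [huR]; linarith, by rw [huR]; linarith⟩, (hagree u huR).symm⟩
  obtain ⟨δ₁, hδ₁, hthick⟩ := (isCompact_sphere (0 : EuclideanSpace ℝ (Fin 4)) R).exists_thickening_subset_open hpre hsph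
  -- the width of the collar
  set ε' : ℝ := min (η₀ / R) (δ₁ / R) / 2 with hε'
  have hε'pos : 0 < ε' := by positivity
  have hε'η : ε' ≤ η₀ / R := by
    have : min (η₀ / R) (δ₁ / R) ≤ η₀ / R := min_le_left _ _
    have : 0 < η₀ / R := by positivity
    rw [hε']; linarith
  have hRε'η : R * ε' < η₀ := by
    have h1 : min (η₀ / R) (δ₁ / R) ≤ η₀ / R := min_le_left _ _
    have h2 : 0 < η₀ / R := by positivity
    have h3 : ε' < η₀ / R := by rw [hε']; linarith
    calc R * ε' < R * (η₀ / R) := by gcongr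
      _ = η₀ := by field_simp
  have hRε'δ : R * ε' < δ₁ := by
    have h1 : min (η₀ / R) (δ₁ / R) ≤ δ₁ / R := min_le_right _ _
    have h2 : 0 < δ₁ / R := by positivity
    have h3 : ε' < δ₁ / R := by rw [hε']; linarith
    calc R * ε' < R * (δ₁ / R) := by gcongr
      _ = δ₁ := by field_simp
  -- points of the closed shell, rescaled by `R`
  have hnormR : ∀ x : EuclideanSpace ℝ (Fin 4), ‖R • x‖ = R * ‖x‖ := fun x => by
    rw [norm_smul, Real.norm_of_nonneg hR.le]
  have hshell : ∀ x : EuclideanSpace ℝ (Fin 4), 1 - ε' < ‖x‖ → ‖x‖ ≤ 1 →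
      R - η₀ < ‖R • x‖ ∧ ‖R • x‖ ≤ R := by
    intro x h1 h2
    rw [hnormR]
    constructor
    · nlinarith
    · nlinarith
  -- (F1) `G (R x)` is a `Λ₀`-value from the ball `B_{R'}`
  have hF1 : ∀ x : EuclideanSpace ℝ (Fin 4), 1 - ε' < ‖x‖ → ‖x‖ ≤ 1 →
      ∃ w ∈ ball (0 : EuclideanSpace ℝ (Fin 4)) R', Λ₀ w = G (R • x) ∧
        (‖x‖ < 1 → ‖w‖ < R) ∧ (‖x‖ = 1 → w = R • x) := by
    intro x h1 h2
    rcases h2.lt_or_eq with hlt | heq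
    · obtain ⟨w, hw, hwG⟩ := hT1 ⟨R • x, ⟨(hshell x h1 h2).1, by rw [hnormR]; nlinarith⟩, rfl⟩
      have hwR : ‖w‖ < R := mem_ball_zero_iff.1 hw
      exact ⟨w, mem_ball_zero_iff.2 (hwR.trans hRR'), hwG, fun _ => hwR,
        fun h => absurd h hlt.ne⟩
    · refine ⟨R • x, mem_ball_zero_iff.2 (by rw [hnormR, heq, mul_one]; exact hRR'),
        hagree _ (by rw [hnormR, heq, mul_one]), fun h => absurd heq h.ne, fun _ => rfl⟩
  -- (F2) `Λ₀ (R x)` is a `G`-value from the open shell `C`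
  have hF2 : ∀ x : EuclideanSpace ℝ (Fin 4), 1 - ε' < ‖x‖ → ‖x‖ ≤ 1 → Λ₀ (R • x) ∈ G '' C := by
    intro x h1 h2
    apply hthick
    rw [Metric.mem_thickening_iff]
    have hx0 : 0 < ‖x‖ := by
      have : ε' < 1 := by
        have : R * ε' < R := hRε'η.trans hη₀R
        nlinarith
      linarith
    refine ⟨(R / ‖R • x‖) • (R • x), ?_, ?_⟩
    · rw [mem_sphere_zero_iff_norm, norm_smul, Real.norm_of_nonneg (by positivity),
        div_mul_cancel₀ _ (by rw [hnormR]; positivity)]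
    · rw [dist_eq_norm]
      have hRx : ‖R • x‖ = R * ‖x‖ := hnormR x
      have hpos : 0 < R * ‖x‖ := by positivity
      have : R • x - (R / ‖R • x‖) • (R • x) = (1 - R / ‖R • x‖) • (R • x) := by
        rw [sub_smul, one_smul]
      rw [this, norm_smul, hRx, Real.norm_eq_abs, abs_of_nonpos, neg_sub, sub_mul,
        div_mul_cancel₀ _ hpos.ne', one_mul]
      · nlinarith
      · rw [sub_nonpos, le_div_iff₀ hpos, one_mul]
        nlinarith
  -- the collar maps
  obtain ⟨θ, hθ⟩ : ∃ θ : EuclideanSpace ℝ (Fin 4) → EuclideanSpace ℝ (Fin 4),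
      θ = fun x => R⁻¹ • Λinv (G (R • x)) := ⟨_, rfl⟩
  obtain ⟨θinv, hθinv⟩ : ∃ θinv : EuclideanSpace ℝ (Fin 4) → EuclideanSpace ℝ (Fin 4),
      θinv = fun x => R⁻¹ • Ginv (Λ₀ (R • x)) := ⟨_, rfl⟩
  -- `Λ₀ ∘ Λinv = id` on `Λ₀(B_{R'})`, `R θ x = Λinv (G (R x))`
  have hRθ : ∀ x : EuclideanSpace ℝ (Fin 4), R • θ x = Λinv (G (R • x)) := fun x => by
    rw [hθ, smul_smul, mul_inv_cancel₀ hR.ne', one_smul]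
  have hkey : ∀ x : EuclideanSpace ℝ (Fin 4), 1 - ε' < ‖x‖ → ‖x‖ ≤ 1 →
      Λ₀ (R • θ x) = G (R • x) := by
    intro x h1 h2
    obtain ⟨w, hw, hwG, -, -⟩ := hF1 x h1 h2
    rw [hRθ, ← hwG, hΛleft w hw]
  have hmem_shell : ∀ {x : EuclideanSpace ℝ (Fin 4)},
      x ∈ (Literature.Topology.FourManifolds.closedShell ε' : Set (EuclideanSpace ℝ (Fin 4))) →
        1 - ε' < ‖x‖ ∧ ‖x‖ ≤ 1 := fun hx =>
    Literature.Topology.FourManifolds.mem_closedShell_iff.1 hx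
  refine ⟨ε', θ, θinv, hε'pos, hε'η, ⟨hε'pos, ?_, ?_, ?_, ?_, ?_, ?_⟩, hkey⟩
  · -- `θ` is smooth on the closed shell
    have hW : IsOpen {x : EuclideanSpace ℝ (Fin 4) | G (R • x) ∈ Λ₀ '' ball 0 R'} :=
      hΛopen.preimage (hG.continuous.comp (continuous_const_smul R))
    have hsm : ContDiffOn ℝ ∞ (fun x => R⁻¹ • Λinv (G (R • x)))
        {x : EuclideanSpace ℝ (Fin 4) | G (R • x) ∈ Λ₀ '' ball 0 R'} :=
      ((hΛsmooth.comp (hG.comp (contDiff_const_smul R)).contDiffOn fun x hx => hx)).const_smul R⁻¹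
    rw [hθ]
    refine hsm.mono fun x hx => ?_
    obtain ⟨h1, h2⟩ := hmem_shell hx
    obtain ⟨w, hw, hwG, -, -⟩ := hF1 x h1 h2
    exact ⟨w, hw, hwG⟩
  · -- `θinv` is smooth on the closed shell
    have hW : IsOpen {x : EuclideanSpace ℝ (Fin 4) | Λ₀ (R • x) ∈ G '' C} :=
      hGopen.preimage (hΛ.continuous.comp (continuous_const_smul R))
    have hsm : ContDiffOn ℝ ∞ (fun x => R⁻¹ • Ginv (Λ₀ (R • x)))
        {x : EuclideanSpace ℝ (Fin 4) | Λ₀ (R • x) ∈ G '' C} :=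
      ((hGsmooth.comp (hΛ.comp (contDiff_const_smul R)).contDiffOn fun x hx => hx)).const_smul R⁻¹
    rw [hθinv]
    refine hsm.mono fun x hx => ?_
    obtain ⟨h1, h2⟩ := hmem_shell hx
    exact hF2 x h1 h2
  · -- `θ` fixes the unit sphere
    intro x hx
    have hRx : R • x ∈ ball (0 : EuclideanSpace ℝ (Fin 4)) R' := by
      rw [mem_ball_zero_iff, hnormR, hx, mul_one]; exact hRR'
    have : R • θ x = R • x := by
      rw [hRθ, ← hagree _ (by rw [hnormR, hx, mul_one]), hΛleft _ hRx]
    exact smul_right_injective _ hR.ne' this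
  · -- into the closed ball
    intro x hx
    obtain ⟨h1, h2⟩ := hmem_shell hx
    obtain ⟨w, hw, hwG, hlt, heq⟩ := hF1 x h1 h2
    have hθx : R • θ x = w := by rw [hRθ, ← hwG, hΛleft w hw]
    have hn : R * ‖θ x‖ = ‖w‖ := by rw [← hnormR, hθx]
    rcases h2.lt_or_eq with h | h
    · have := hlt h
      nlinarith
    · rw [heq h, hnormR, h, mul_one] at hn
      nlinarith
  · -- the open shell into the open ball
    intro x hx hx1
    obtain ⟨h1, h2⟩ := hmem_shell hx
    obtain ⟨w, hw, hwG, hlt, -⟩ := hF1 x h1 h2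
    have hθx : R • θ x = w := by rw [hRθ, ← hwG, hΛleft w hw]
    have hn : R * ‖θ x‖ = ‖w‖ := by rw [← hnormR, hθx]
    have := hlt hx1
    nlinarith
  · -- the left inverse
    intro x hx _
    obtain ⟨h1, h2⟩ := hmem_shell hx
    have hRx : R • x ∈ C := by
      obtain ⟨ha, hb⟩ := hshell x h1 h2
      exact ⟨ha, by linarith⟩
    rw [hθinv]
    show R⁻¹ • Ginv (Λ₀ (R • θ x)) = x
    rw [hkey x h1 h2, hGleft _ hRx, smul_smul, inv_mul_cancel₀ hR.ne', one_smul]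

end Collar

end Summit.SmoothPoincare4.SmoothPoincare4.Theorems.OrigamiFoldExistence.ShadowPleats

end
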